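import Summits.MatrixMultiplication.MatrixMultiplication.Theorems.LevelGradedCohnUmansLevelOneGL2DesignsNearLink
import Summits.MatrixMultiplication.MatrixMultiplication.Theorems.LevelGradedCohnUmansLevelOneGL2DesignsMultiquadraticAllPrimes

/-!
# What is left of the crux `LevelOneGL2Designs` for its consumer: a NEAR-`3/2` TRANSFER (wall-breaker axis `parabola lifts
over finite fields`, stub `stub_tangencySets`, stmt-MatrixMultiplication-14080)

One declaration for the planner, composing this seat's three results:

* packing (`Multiquadratic.stubFormat_near_threeHalves_allPrimes`): for every `ε > 0`, strong representative systems of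
  `AG(2,p)` with `≥ c_ε p^{3/2−ε}` flags exist for EVERY sufficiently large prime `p` (kernel-checked, new beyond print);
* link (`NearLink.lieRankDesigns_of_levelOneGL2Near`): rank-`1`-separated `X, Y, Z ⊆ GL₂(𝔽_p)` of size `c·p^{3/2−δ}` for every
  `δ > 0` already give `LieRankDesigns`;
* hence `lieRankDesigns_of_nearTransfer`: **`LieRankDesigns` follows from a TRANSFER at exponent `3/2 − δ`** — a map turning,
  for each `δ > 0`, an all-large-primes family of SRS of size `c·p^{3/2−δ}` into rank-`1`-separated triples of size
  `c'·p^{3/2−δ}` along unboundedly many primes.  The hypothesis is stated with the SRS family in the stub's exact flag format,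
  so a future line proves exactly `NearTransfer` and nothing about tangency sets.

At exponent exactly `3/2` both halves are open (the stub) or dead (`stub_flagTransfer`, `Lines/Sketch-dead.md`); at `3/2 − δ`
the packing half is a theorem and the Roth mechanism of the dead-line analysis is void (Behrend-type ratio sets), see
`Cruxes/LevelOneGL2Designs/AxisK11Seat2ParabolaLifts.md`.  No definitions (the transfer hypothesis is spelled out inline).
-/

-- `Summit.<Summit>.<Problem>` is the tree's mandated summit-side namespace; for this
-- single-conjunct summit the two coincide, so the file silences `dupNamespace`.
set_option linter.dupNamespace false

noncomputable section

open scoped BigOperators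
open Matrix

namespace Summit.MatrixMultiplication.MatrixMultiplication.Theorems.LevelOneGL2Designs.NearLink

open Summit.MatrixMultiplication.MatrixMultiplication.Theses.LevelGradedCohnUmans

/-- **`LieRankDesigns` from a near-`3/2` transfer.**  Suppose that for every `δ > 0`, every constant `c > 0` and threshold
`q₀`, a family of strong representative systems of `AG(2,p)` with `≥ c·p^{3/2−δ}` flags for all primes `p ≥ q₀` can be turned
into rank-`1`-separated `X, Y, Z ⊆ GL₂(𝔽_p)` with `|X|, |Y|, |Z| ≥ c'·p^{3/2−δ}` along unboundedly many primes (`c' > 0`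
depending on `δ, c, q₀`).  Then `LieRankDesigns` holds — because the SRS family EXISTS for every `δ > 0`
(`Multiquadratic.stubFormat_near_threeHalves_allPrimes`) and near-`3/2` level-one designs suffice
(`lieRankDesigns_of_levelOneGL2Near`).  This is the whole residual of the crux for the route. [composition of this seat's results] -/
theorem lieRankDesigns_of_nearTransfer
    (hT : ∀ δ : ℝ, 0 < δ → ∀ c : ℝ, 0 < c → ∀ q₀ : ℕ,
      (∀ p : ℕ, p.Prime → q₀ ≤ p → ∃ S : Finset ((Fin 2 → ZMod p) × (Fin 2 → ZMod p)),
        c * (p : ℝ) ^ (3 / 2 - δ : ℝ) ≤ S.card ∧ ∀ f ∈ S, ∀ f' ∈ S, (dotProduct f.1 f'.2 = 1 ↔ f = f')) →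
      ∃ c' : ℝ, 0 < c' ∧ ∀ p₀ : ℕ, ∃ (p : ℕ) (_ : Fact p.Prime), p₀ ≤ p ∧
        ∃ X Y Z : Finset (Matrix.GeneralLinearGroup (Fin 2) (ZMod p)),
          (∀ x₀ ∈ X, ∀ z₀ ∈ Z, ∃ c : Matrix (Fin 2) (Fin 2) (ZMod p) → ℂ, (∀ M, 1 < M.rank → c M = 0) ∧
            ∀ x ∈ X, ∀ y ∈ Y, ∀ y' ∈ Y, ∀ z ∈ Z,
              (∑ M : Matrix (Fin 2) (Fin 2) (ZMod p), c M * ZMod.stdAddChar (Matrix.trace (M *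
                ((x⁻¹ * y * y'⁻¹ * z : Matrix.GeneralLinearGroup (Fin 2) (ZMod p)) :
                  Matrix (Fin 2) (Fin 2) (ZMod p))))) = if x = x₀ ∧ y = y' ∧ z = z₀ then 1 else 0) ∧
          c' * (p : ℝ) ^ (3 / 2 - δ : ℝ) ≤ X.card ∧ c' * (p : ℝ) ^ (3 / 2 - δ : ℝ) ≤ Y.card ∧
            c' * (p : ℝ) ^ (3 / 2 - δ : ℝ) ≤ Z.card) :
    LieRankDesigns := by
  refine lieRankDesigns_of_levelOneGL2Near fun δ hδ => ?_
  obtain ⟨c, hc, q₀, hall⟩ := Multiquadratic.stubFormat_near_threeHalves_allPrimes δ hδ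
  exact hT δ hδ c hc q₀ hall

end Summit.MatrixMultiplication.MatrixMultiplication.Theorems.LevelOneGL2Designs.NearLink
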